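import Summits.AtomisticToContinuum.BoseEinsteinCondensation.Theorems.BoxCountShadowTruncation
import HarnessLib

/-!
# BoxCountShadowClosedToTrial — from the closed form to the `C¹` core with the truncated variance (S3 of the CoercivityLine)

If the closed energy form of `H_N` at the real wave function `Φ` is `< E`, then for every `δ > 0` some
Dirichlet trial state `Ψ` (symmetric `C¹` core) has `⟨Ψ, H_N Ψ⟩ < E` and
`V_T(Φ) ≤ V_T(|Ψ|) + δ`, where `V_T = countVarianceTrunc L K` is the truncated count variance
(`Σ_B K⁻³ ∫ min((N_B/λ − 1)², 1) |·|²`, weights in `[0,1]`).  Proof: `closedEnergy` is the infimum over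
`L²`-approximating sequences of trial states of `liminf ⟨Φ_k, H Φ_k⟩` (`GroundState.closedEnergy`), so some `Φ_k → Φ`
in `L²` has energies frequently `< E`; and `V_T` is `L²`-upper-semicontinuous along normalised sequences by
the elementary bound `Φ² ≤ (1+t)|Ψ|² + (1+1/t)|Ψ − Φ|²` with the weights `≤ 1` and `∫|Ψ|² = 1`:
`V_T(Φ) ≤ V_T(|Ψ|) + t + (1+1/t)‖Ψ − Φ‖₂²`.

This is stub S3 `ClosedToTrial` of the COERC_h skeleton (node g36 «DensityCoercivity»), now a theorem:
`closedToTrial_holds`.  No instances, no notation, no sorry.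
-/

noncomputable section

open MeasureTheory Filter Set Topology
open scoped ENNReal NNReal BigOperators

namespace Summit.AtomisticToContinuum.BoseEinsteinCondensation.Theorems.BoxCountShadow

open Literature.MathematicalPhysics.QuantumManyBody.BoseGas
open Summit.AtomisticToContinuum.BoseEinsteinCondensation.Theorems.BoxLatticeFSum
open Summit.AtomisticToContinuum.BoseEinsteinCondensation.Theorems.BoxLabelAffinity
open Summit.AtomisticToContinuum.BoseEinsteinCondensation.Theorems.BoxHorizonAffinity

variable {n : ℕ}

/-! ### The truncation factor -/

/-- The truncation factor `min((N_B(X)/λ − 1)², 1) ∈ [0,1]` of cell `B` at configuration `X` (`λ = (n+1)/K³`).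
[folklore] -/
def truncFactor (L : ℝ) (K : ℕ) (X : Config (n + 1)) (B : SubIdx K) : ℝ≥0∞ :=
  ENNReal.ofReal (min ((((countVec (L / (K : ℝ)) K X B : ℕ) : ℝ) / (((n + 1 : ℕ) : ℝ) / (K : ℝ) ^ 3) - 1) ^ 2) 1)

/-- `countVarianceTrunc` in terms of the truncation factor (definitional). [folklore] -/
theorem countVarianceTrunc_eq (L : ℝ) (K : ℕ) (Φ : Config (n + 1) → ℝ) :
    countVarianceTrunc L K Φ =
      ∑ B : SubIdx K, blockWeight K ^ 2 * ∫⁻ X, truncFactor L K X B * ENNReal.ofReal (Φ X) ^ 2 :=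
  rfl

/-- The truncation factor is at most `1`. [folklore] -/
theorem truncFactor_le_one (L : ℝ) (K : ℕ) (X : Config (n + 1)) (B : SubIdx K) : truncFactor L K X B ≤ 1 :=
  ENNReal.ofReal_le_one.2 (min_le_right _ _)

/-- The truncation factor is measurable in the configuration. [folklore] -/
theorem measurable_truncFactor (L : ℝ) (K : ℕ) (B : SubIdx K) :
    Measurable fun X : Config (n + 1) => truncFactor L K X B :=
  (measurable_of_countable fun k : ℕ =>
      ENNReal.ofReal (min ((((k : ℕ) : ℝ) / (((n + 1 : ℕ) : ℝ) / (K : ℝ) ^ 3) - 1) ^ 2) 1)).comp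
    ((measurable_pi_apply B).comp (measurable_countVec (L / (K : ℝ)) K))

/-- The block weights sum to at most `1` (`= 1` for `K ≥ 1`, empty sum for `K = 0`). [folklore] -/
theorem sum_blockWeight_sq_le_one (K : ℕ) : ∑ _B : SubIdx K, blockWeight K ^ 2 ≤ 1 := by
  rcases Nat.eq_zero_or_pos K with hK | hK
  · subst hK
    have : IsEmpty (SubIdx 0) := by
      change IsEmpty (Fin 3 → Fin 0); infer_instance
    simp
  · exact (sum_blockWeight_sq hK).le

/-! ### The elementary `L²` bound -/

/-- `(u + d)² ≤ (1+t)u² + (1+1/t)d²` for `t > 0`. [folklore] -/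
theorem add_sq_le_of_pos {t : ℝ} (ht : 0 < t) (u d : ℝ) :
    (u + d) ^ 2 ≤ (1 + t) * u ^ 2 + (1 + 1 / t) * d ^ 2 := by
  have ht0 : t ≠ 0 := ht.ne'
  have h : 0 ≤ (t * u - d) ^ 2 := sq_nonneg _
  have key : t * ((1 + t) * u ^ 2 + (1 + 1 / t) * d ^ 2 - (u + d) ^ 2) = (t * u - d) ^ 2 := by
    field_simp
    ring
  have h2 : 0 ≤ t * ((1 + t) * u ^ 2 + (1 + 1 / t) * d ^ 2 - (u + d) ^ 2) := by rw [key]; exact h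
  have h3 := (mul_nonneg_iff_of_pos_left ht).1 h2
  linarith

/-- Pointwise: `(Φ⁺)² ≤ (1+t)|z|² + (1+1/t)|z − Φ|²` in `ℝ≥0∞`, for a real value `r = Φ(X)` and a complex value
`z = Ψ(X)`. [folklore] -/
theorem ofReal_sq_le_of_pos {t : ℝ} (ht : 0 < t) (r : ℝ) (z : ℂ) :
    ENNReal.ofReal r ^ 2 ≤
      ENNReal.ofReal (1 + t) * (‖z‖₊ : ℝ≥0∞) ^ 2 + ENNReal.ofReal (1 + 1 / t) * (‖z - (r : ℂ)‖₊ : ℝ≥0∞) ^ 2 := by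
  have hn : ∀ w : ℂ, (‖w‖₊ : ℝ≥0∞) = ENNReal.ofReal ‖w‖ := fun w => by
    rw [← coe_nnnorm, ENNReal.ofReal_coe_nnreal]
  have habs : |r| ≤ ‖z‖ + ‖z - (r : ℂ)‖ := by
    have h := norm_le_insert z (r : ℂ)
    rwa [Complex.norm_real, Real.norm_eq_abs] at h
  have hreal : |r| ^ 2 ≤ (1 + t) * ‖z‖ ^ 2 + (1 + 1 / t) * ‖z - (r : ℂ)‖ ^ 2 :=
    (pow_le_pow_left₀ (abs_nonneg r) habs 2).trans (add_sq_le_of_pos ht _ _)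
  have ht1 : 0 ≤ 1 + 1 / t := by positivity
  calc ENNReal.ofReal r ^ 2 ≤ ENNReal.ofReal |r| ^ 2 := by
        gcongr; exact le_abs_self r
    _ = ENNReal.ofReal (|r| ^ 2) := (ENNReal.ofReal_pow (abs_nonneg r) 2).symm
    _ ≤ ENNReal.ofReal ((1 + t) * ‖z‖ ^ 2 + (1 + 1 / t) * ‖z - (r : ℂ)‖ ^ 2) := ENNReal.ofReal_le_ofReal hreal
    _ = ENNReal.ofReal (1 + t) * (‖z‖₊ : ℝ≥0∞) ^ 2 +
          ENNReal.ofReal (1 + 1 / t) * (‖z - (r : ℂ)‖₊ : ℝ≥0∞) ^ 2 := by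
        rw [ENNReal.ofReal_add (by positivity) (by positivity), ENNReal.ofReal_mul (by linarith),
          ENNReal.ofReal_mul ht1, ENNReal.ofReal_pow (norm_nonneg _), ENNReal.ofReal_pow (norm_nonneg _),
          hn, hn]

/-- **`L²`-upper-semicontinuity of the truncated variance along normalised states**: for a trial state `Ψ`,
a real `Φ` and `t > 0`, `V_T(Φ) ≤ V_T(|Ψ|) + t + (1 + 1/t) ∫ |Ψ − Φ|²`. [folklore] -/
theorem countVarianceTrunc_le_of_trialState (L : ℝ) (K : ℕ) {Φ : Config (n + 1) → ℝ}
    (Ψ : TrialState (n + 1) L) {t : ℝ} (ht : 0 < t) :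
    countVarianceTrunc L K Φ ≤ countVarianceTrunc L K (fun X => ‖Ψ.ψ X‖) + ENNReal.ofReal t +
      ENNReal.ofReal (1 + 1 / t) * ∫⁻ X, (‖Ψ.ψ X - (Φ X : ℂ)‖₊ : ℝ≥0∞) ^ 2 := by
  have hψm : Measurable Ψ.ψ := Ψ.contDiff.continuous.measurable
  have hψ2 : Measurable fun X => (‖Ψ.ψ X‖₊ : ℝ≥0∞) ^ 2 := (hψm.nnnorm.coe_nnreal_ennreal).pow_const 2
  have hn : ∀ X, ENNReal.ofReal ‖Ψ.ψ X‖ = (‖Ψ.ψ X‖₊ : ℝ≥0∞) := fun X => by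
    rw [← coe_nnnorm, ENNReal.ofReal_coe_nnreal]
  -- the two variances in `truncFactor` form
  have hVΦ := countVarianceTrunc_eq L K Φ
  have hVΨ : countVarianceTrunc L K (fun X => ‖Ψ.ψ X‖) =
      ∑ B : SubIdx K, blockWeight K ^ 2 * ∫⁻ X, truncFactor L K X B * (‖Ψ.ψ X‖₊ : ℝ≥0∞) ^ 2 := by
    rw [countVarianceTrunc_eq]
    simp_rw [hn]
  -- per cell
  have hint : ∀ B : SubIdx K, ∫⁻ X, truncFactor L K X B * ENNReal.ofReal (Φ X) ^ 2 ≤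
      ENNReal.ofReal (1 + t) * (∫⁻ X, truncFactor L K X B * (‖Ψ.ψ X‖₊ : ℝ≥0∞) ^ 2) +
        ENNReal.ofReal (1 + 1 / t) * ∫⁻ X, (‖Ψ.ψ X - (Φ X : ℂ)‖₊ : ℝ≥0∞) ^ 2 := by
    intro B
    have hm0 : Measurable fun X => truncFactor L K X B * (‖Ψ.ψ X‖₊ : ℝ≥0∞) ^ 2 :=
      (measurable_truncFactor L K B).mul hψ2
    have hm1 : Measurable fun X => ENNReal.ofReal (1 + t) * (truncFactor L K X B * (‖Ψ.ψ X‖₊ : ℝ≥0∞) ^ 2) :=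
      hm0.const_mul _
    calc ∫⁻ X, truncFactor L K X B * ENNReal.ofReal (Φ X) ^ 2
        ≤ ∫⁻ X, (ENNReal.ofReal (1 + t) * (truncFactor L K X B * (‖Ψ.ψ X‖₊ : ℝ≥0∞) ^ 2) +
            ENNReal.ofReal (1 + 1 / t) * (‖Ψ.ψ X - (Φ X : ℂ)‖₊ : ℝ≥0∞) ^ 2) := by
          refine lintegral_mono fun X => ?_
          calc truncFactor L K X B * ENNReal.ofReal (Φ X) ^ 2
              ≤ truncFactor L K X B * (ENNReal.ofReal (1 + t) * (‖Ψ.ψ X‖₊ : ℝ≥0∞) ^ 2 +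
                  ENNReal.ofReal (1 + 1 / t) * (‖Ψ.ψ X - (Φ X : ℂ)‖₊ : ℝ≥0∞) ^ 2) :=
                mul_le_mul' le_rfl (ofReal_sq_le_of_pos ht (Φ X) (Ψ.ψ X))
            _ = ENNReal.ofReal (1 + t) * (truncFactor L K X B * (‖Ψ.ψ X‖₊ : ℝ≥0∞) ^ 2) +
                  truncFactor L K X B * (ENNReal.ofReal (1 + 1 / t) * (‖Ψ.ψ X - (Φ X : ℂ)‖₊ : ℝ≥0∞) ^ 2) := by
                ring
            _ ≤ _ := add_le_add le_rfl (mul_le_of_le_one_left' (truncFactor_le_one L K X B))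
      _ = _ := by
          rw [lintegral_add_left hm1, lintegral_const_mul _ hm0, lintegral_const_mul' _ _ ENNReal.ofReal_ne_top]
  -- `V_T(|Ψ|) ≤ 1`
  have hV1 : (∑ B : SubIdx K, blockWeight K ^ 2 * ∫⁻ X, truncFactor L K X B * (‖Ψ.ψ X‖₊ : ℝ≥0∞) ^ 2) ≤ 1 := by
    calc (∑ B : SubIdx K, blockWeight K ^ 2 * ∫⁻ X, truncFactor L K X B * (‖Ψ.ψ X‖₊ : ℝ≥0∞) ^ 2)
        ≤ ∑ _B : SubIdx K, blockWeight K ^ 2 * 1 := by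
          gcongr with B
          calc ∫⁻ X, truncFactor L K X B * (‖Ψ.ψ X‖₊ : ℝ≥0∞) ^ 2 ≤ ∫⁻ X, (‖Ψ.ψ X‖₊ : ℝ≥0∞) ^ 2 :=
                lintegral_mono fun X => mul_le_of_le_one_left' (truncFactor_le_one L K X B)
            _ = 1 := Ψ.norm_eq
      _ ≤ 1 := by simpa only [mul_one] using sum_blockWeight_sq_le_one K
  -- sum over the cells
  rw [hVΦ, hVΨ]
  set V : ℝ≥0∞ := ∑ B : SubIdx K, blockWeight K ^ 2 * ∫⁻ X, truncFactor L K X B * (‖Ψ.ψ X‖₊ : ℝ≥0∞) ^ 2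
    with hVdef
  set ε : ℝ≥0∞ := ∫⁻ X, (‖Ψ.ψ X - (Φ X : ℂ)‖₊ : ℝ≥0∞) ^ 2 with hεdef
  calc (∑ B : SubIdx K, blockWeight K ^ 2 * ∫⁻ X, truncFactor L K X B * ENNReal.ofReal (Φ X) ^ 2)
      ≤ ∑ B : SubIdx K, blockWeight K ^ 2 *
          (ENNReal.ofReal (1 + t) * (∫⁻ X, truncFactor L K X B * (‖Ψ.ψ X‖₊ : ℝ≥0∞) ^ 2) +
            ENNReal.ofReal (1 + 1 / t) * ε) := by
        gcongr with B
        exact hint B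
    _ = ENNReal.ofReal (1 + t) * V + (∑ _B : SubIdx K, blockWeight K ^ 2) * (ENNReal.ofReal (1 + 1 / t) * ε) := by
        rw [hVdef, Finset.mul_sum, Finset.sum_mul, ← Finset.sum_add_distrib]
        refine Finset.sum_congr rfl fun B _ => ?_
        ring
    _ ≤ ENNReal.ofReal (1 + t) * V + 1 * (ENNReal.ofReal (1 + 1 / t) * ε) := by
        gcongr
        exact sum_blockWeight_sq_le_one K
    _ = V + ENNReal.ofReal t * V + ENNReal.ofReal (1 + 1 / t) * ε := by
        rw [ENNReal.ofReal_add zero_le_one ht.le, ENNReal.ofReal_one, add_mul, one_mul, one_mul]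
    _ ≤ V + ENNReal.ofReal t * 1 + ENNReal.ofReal (1 + 1 / t) * ε := by
        gcongr
    _ = V + ENNReal.ofReal t + ENNReal.ofReal (1 + 1 / t) * ε := by rw [mul_one]

/-! ### S3 -/

/-- **From the closed form to the `C¹` core, with the truncated variance** (stub S3 `ClosedToTrial` of the COERC_h
skeleton): if `closedEnergy v L Φ < E` then for every `δ > 0` some trial state `Ψ` has `energy v Ψ < E` and
`countVarianceTrunc L K Φ ≤ countVarianceTrunc L K |Ψ| + δ`. [cite: Kato1966, VI §1.3 Thm 1.16] -/
theorem closedToTrial_holds :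
    ∀ (v : ℝ → ℝ≥0∞) (n : ℕ) (L : ℝ) (K : ℕ) (Φ : Config (n + 1) → ℝ), Measurable Φ →
      ∀ E : ℝ≥0∞, closedEnergy v L (fun X => (Φ X : ℂ)) < E → ∀ δ : ℝ≥0∞, 0 < δ →
        ∃ Ψ : TrialState (n + 1) L, energy v Ψ < E ∧
          countVarianceTrunc L K Φ ≤ countVarianceTrunc L K (fun X => ‖Ψ.ψ X‖) + δ := by
  intro v n L K Φ _hΦm E hcl δ hδ
  -- an `L²`-approximating sequence of trial states with energies frequently below `E`
  obtain ⟨Ψs, hT2, hlim⟩ : ∃ Ψs : ℕ → TrialState (n + 1) L,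
      TendstoL2 Ψs (fun X => (Φ X : ℂ)) ∧ liminf (fun k => energy v (Ψs k)) atTop < E := by
    unfold closedEnergy at hcl
    obtain ⟨Ψs, h⟩ := iInf_lt_iff.1 hcl
    obtain ⟨hT2, h⟩ := iInf_lt_iff.1 h
    exact ⟨Ψs, hT2, h⟩
  have hfreq : ∃ᶠ k in atTop, energy v (Ψs k) < E := frequently_lt_of_liminf_lt (h := hlim)
  have hT2' : Tendsto (fun k => ∫⁻ X, (‖(Ψs k).ψ X - (Φ X : ℂ)‖₊ : ℝ≥0∞) ^ 2) atTop (𝓝 0) := hT2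
  -- budget `δ' = min δ 1`, `t = δ'/2`
  set δ' : ℝ≥0∞ := min δ 1 with hδ'def
  have hδ'pos : 0 < δ' := lt_min hδ one_pos
  have hδ'top : δ' ≠ ⊤ := ne_top_of_le_ne_top ENNReal.one_ne_top (min_le_right _ _)
  have hδ'δ : δ' ≤ δ := min_le_left _ _
  have htR : 0 < δ'.toReal := ENNReal.toReal_pos hδ'pos.ne' hδ'top
  set t : ℝ := δ'.toReal / 2 with htdef
  have ht : 0 < t := by positivity
  have hoft : ENNReal.ofReal t = δ' / 2 := by
    rw [htdef, ENNReal.ofReal_div_of_pos two_pos, ENNReal.ofReal_toReal hδ'top, ENNReal.ofReal_ofNat]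
  have h2pos : 0 < δ' / 2 := ENNReal.half_pos hδ'pos.ne'
  have hev : ∀ᶠ k in atTop,
      ENNReal.ofReal (1 + 1 / t) * ∫⁻ X, (‖(Ψs k).ψ X - (Φ X : ℂ)‖₊ : ℝ≥0∞) ^ 2 < δ' / 2 := by
    have h0 : Tendsto (fun k => ENNReal.ofReal (1 + 1 / t) *
        ∫⁻ X, (‖(Ψs k).ψ X - (Φ X : ℂ)‖₊ : ℝ≥0∞) ^ 2) atTop (𝓝 0) := by
      have h := ENNReal.Tendsto.const_mul (a := ENNReal.ofReal (1 + 1 / t)) hT2' (Or.inr ENNReal.ofReal_ne_top)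
      rw [mul_zero] at h
      exact h
    exact h0.eventually (gt_mem_nhds h2pos)
  obtain ⟨k, hkE, hkε⟩ := (hfreq.and_eventually hev).exists
  refine ⟨Ψs k, hkE, ?_⟩
  calc countVarianceTrunc L K Φ
      ≤ countVarianceTrunc L K (fun X => ‖(Ψs k).ψ X‖) + ENNReal.ofReal t +
          ENNReal.ofReal (1 + 1 / t) * ∫⁻ X, (‖(Ψs k).ψ X - (Φ X : ℂ)‖₊ : ℝ≥0∞) ^ 2 :=
        countVarianceTrunc_le_of_trialState L K (Ψs k) ht
    _ ≤ countVarianceTrunc L K (fun X => ‖(Ψs k).ψ X‖) + δ' / 2 + δ' / 2 := by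
        rw [hoft]
        exact add_le_add le_rfl hkε.le
    _ = countVarianceTrunc L K (fun X => ‖(Ψs k).ψ X‖) + δ' := by rw [add_assoc, ENNReal.add_halves]
    _ ≤ countVarianceTrunc L K (fun X => ‖(Ψs k).ψ X‖) + δ := by gcongr

end Summit.AtomisticToContinuum.BoseEinsteinCondensation.Theorems.BoxCountShadow

end
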